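import Summits.FinalStateConjecture.FinalStateConjecture.Theorems.NearExtremalKappaCapture.Negative.ExponentMonotonicity

/-!
# `NearExtremalKappaCapture` (crux stmt-FinalStateConjecture-10606, route PhaseMixingCapture),
# line `polynomial-closure`: the parameter box of the corrected transfer stays sub-extremal and
# `κ`-comparable (negative-side support, drefute seat gen 2)

The gen-2 correction of the line's transfer stub (`Cruxes/NearExtremalKappaCapture/DrefuteG2Corrected.lean`,
`PolynomialClosingG2`; notes `DrefuteG2NoteStubPolynomialClosing.md`) feeds the nonlinear closing step the
linear spin-`±2` law at EVERY parameter pair of the box `|M' − M| + |a' − a| ≤ M χ / 8`,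
`χ = 1 − (a/M)²`, around the reference `(M, a)` — because capture lands on `Kerr(M', a') ≠ Kerr(M, a)`
and a black-box law does not transport across a stationary parameter shift. The bookkeeping facts a
reshaped composition needs are proved here, `sorry`-free:

* `isSubextremal_of_box` — the box lies inside the sub-extremal family (`|a'| < M'`);
* `box_mass_pos`, `box_mass_bounds` — `7M/8 ≤ M' ≤ 9M/8` (so `M' ∈ [M/2, 2M]`, the mass window on
  which the corrected `C⁺` delivers ONE constant);
* `kappaSq_box_ge` / `kappaSq_box_le` — `χ/3 ≤ χ' ≤ 3χ` for `χ' = 1 − (a'/M')²`;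
* `box_spin_ge` — if `|a| ≥ ((2a₁+1)/3) M` then every box spin has `a₁ M' ≤ |a'|` (take
  `a₁_crux := (2a₁+1)/3 < 1`, `box_threshold_lt_one`);
* `rpow_neg_box_le` — hence `χ'^{−p} ≤ 3^p χ^{−p}` for `p ≥ 0`: the law's constant `C χ'^{−p}` at any
  box member is at most `Λ := 3^p C χ^{−p}`, so the exponent bookkeeping `γ = p_crux = γ₀ + pN` of the
  skeleton's `NearExtremalKappaCapture_of` survives the correction with `c, C` rescaled by `3^{∓pN}`.

Elementary real arithmetic; no statement of the route is asserted. [folklore]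
-/

noncomputable section

set_option linter.dupNamespace false

namespace Summit.FinalStateConjecture.FinalStateConjecture.Theorems.NearExtremalKappaCapture.Negative

open Literature.Geometry.Lorentzian

/-- `M χ ≤ 2 (M − |a|)` for sub-extremal `(M, a)` (`χ = (1 − |a|/M)(1 + |a|/M)`, second factor `≤ 2`). -/
theorem mass_mul_kappaSq_le {M a : ℝ} (h : Kerr.IsSubextremal M a) :
    M * (1 - (a / M) ^ 2) ≤ 2 * (M - |a|) := by
  have hM : 0 < M := h.pos
  have ha : |a| < M := h
  have e : M * (1 - (a / M) ^ 2) = (M - |a|) * ((M + |a|) / M) := by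
    field_simp
    rw [← sq_abs a]
    ring
  rw [e]
  have h2 : (M + |a|) / M ≤ 2 := by
    rw [div_le_iff₀ hM]; linarith
  have h0 : 0 ≤ M - |a| := by linarith
  nlinarith [mul_le_mul_of_nonneg_left h2 h0]

/-- `M − |a| ≤ M χ` for sub-extremal `(M, a)` (second factor `≥ 1`). -/
theorem sub_abs_le_mass_mul_kappaSq {M a : ℝ} (h : Kerr.IsSubextremal M a) :
    M - |a| ≤ M * (1 - (a / M) ^ 2) := by
  have hM : 0 < M := h.pos
  have ha : |a| < M := h
  have e : M * (1 - (a / M) ^ 2) = (M - |a|) * ((M + |a|) / M) := by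
    field_simp
    rw [← sq_abs a]
    ring
  rw [e]
  have h2 : 1 ≤ (M + |a|) / M := by
    rw [le_div_iff₀ hM]; linarith [abs_nonneg a]
  have h0 : 0 ≤ M - |a| := by linarith
  nlinarith [mul_le_mul_of_nonneg_left h2 h0]

/-- **The box stays sub-extremal**: `|M' − M| + |a' − a| ≤ Mχ/8` and `|a| < M` give `|a'| < M'`. -/
theorem isSubextremal_of_box {M a M' a' : ℝ} (h : Kerr.IsSubextremal M a)
    (hbox : |M' - M| + |a' - a| ≤ M * (1 - (a / M) ^ 2) / 8) : Kerr.IsSubextremal M' a' := by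
  have ha : |a| < M := h
  have hχ := mass_mul_kappaSq_le h
  have h3 : |a'| ≤ |a| + |a' - a| := by
    calc |a'| = |a + (a' - a)| := by ring_nf
      _ ≤ |a| + |a' - a| := abs_add_le _ _
  show |a'| < M'
  nlinarith [abs_nonneg (M' - M), abs_nonneg (a' - a), le_abs_self (M - M'), abs_sub_comm M M']

/-- Mass bounds on the box: `7M/8 ≤ M' ≤ 9M/8` (since `χ ≤ 1`). -/
theorem box_mass_bounds {M a M' a' : ℝ} (h : Kerr.IsSubextremal M a)
    (hbox : |M' - M| + |a' - a| ≤ M * (1 - (a / M) ^ 2) / 8) :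
    7 * M / 8 ≤ M' ∧ M' ≤ 9 * M / 8 := by
  have hM : 0 < M := h.pos
  obtain ⟨hx0, hx1⟩ := kappaSq_pos_le_one h
  have h1 : |M' - M| ≤ M / 8 := by
    have : M * (1 - (a / M) ^ 2) / 8 ≤ M / 8 := by nlinarith
    linarith [abs_nonneg (a' - a)]
  constructor
  · linarith [neg_abs_le (M' - M)]
  · linarith [le_abs_self (M' - M)]

/-- The box mass is positive. -/
theorem box_mass_pos {M a M' a' : ℝ} (h : Kerr.IsSubextremal M a)
    (hbox : |M' - M| + |a' - a| ≤ M * (1 - (a / M) ^ 2) / 8) : 0 < M' := by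
  have := (box_mass_bounds h hbox).1
  linarith [h.pos]

/-- **Lower comparability `χ/3 ≤ χ'`** on the box. Proof: `u' = M' − |a'| ≥ ¾ u` (`u = M − |a|`,
`Mχ ≤ 2u`), `M' ≤ 9M/8`, and `χ' ≥ u'/M'` give `χ' ≥ (2/3)(u/M) ≥ χ/3`. -/
theorem kappaSq_box_ge {M a M' a' : ℝ} (h : Kerr.IsSubextremal M a)
    (hbox : |M' - M| + |a' - a| ≤ M * (1 - (a / M) ^ 2) / 8) :
    (1 - (a / M) ^ 2) / 3 ≤ 1 - (a' / M') ^ 2 := by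
  have hM : 0 < M := h.pos
  have ha : |a| < M := h
  have hM' : 0 < M' := box_mass_pos h hbox
  obtain ⟨-, hM'le⟩ := box_mass_bounds h hbox
  have hsub' : |a'| < M' := isSubextremal_of_box h hbox
  have hχ2 := mass_mul_kappaSq_le h
  -- `u' ≥ u - (|M'-M| + |a'-a|) ≥ u - Mχ/8 ≥ (3/4) u`
  have h3 : |a'| ≤ |a| + |a' - a| := by
    calc |a'| = |a + (a' - a)| := by ring_nf
      _ ≤ |a| + |a' - a| := abs_add_le _ _
  have hu' : 3 * (M - |a|) / 4 ≤ M' - |a'| := by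
    nlinarith [neg_abs_le (M' - M), abs_nonneg (a' - a)]
  -- `χ' = (M' - |a'|)(M' + |a'|)/M'^2 ≥ (M' - |a'|)/M'`
  have hχ' : (M' - |a'|) / M' ≤ 1 - (a' / M') ^ 2 := by
    have e : 1 - (a' / M') ^ 2 = (M' - |a'|) / M' * ((M' + |a'|) / M') := by
      field_simp
      rw [← sq_abs a']
      ring
    rw [e]
    have h1 : 1 ≤ (M' + |a'|) / M' := by
      rw [le_div_iff₀ hM']; linarith [abs_nonneg a']
    have h0 : 0 ≤ (M' - |a'|) / M' := div_nonneg (by linarith) hM'.le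
    nlinarith [mul_le_mul_of_nonneg_left h1 h0]
  -- `χ/3 ≤ (2/3) u / M ≤ (3u/4)/(9M/8) ≤ (M' - |a'|)/M'`
  have hstep : (1 - (a / M) ^ 2) / 3 ≤ (M' - |a'|) / M' := by
    rw [div_le_div_iff₀ (by norm_num : (0:ℝ) < 3) hM']
    -- goal: (1 - (a/M)^2) * M' ≤ (M' - |a'|) * 3
    have hχM : (1 - (a / M) ^ 2) * M ≤ 2 * (M - |a|) := by linarith
    have hkey : (1 - (a / M) ^ 2) * M' ≤ (1 - (a / M) ^ 2) * (9 * M / 8) :=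
      mul_le_mul_of_nonneg_left hM'le (kappaSq_pos_le_one h).1.le
    nlinarith [(kappaSq_pos_le_one h).1]
  exact hstep.trans hχ'

/-- **Upper comparability `χ' ≤ 3χ`** on the box. Proof: `u' ≤ (5/4) u`, `M' ≥ 7M/8`,
`χ' ≤ 2u'/M' ≤ (20/7)(u/M) ≤ (20/7) χ`. -/
theorem kappaSq_box_le {M a M' a' : ℝ} (h : Kerr.IsSubextremal M a)
    (hbox : |M' - M| + |a' - a| ≤ M * (1 - (a / M) ^ 2) / 8) :
    1 - (a' / M') ^ 2 ≤ 3 * (1 - (a / M) ^ 2) := by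
  have hM : 0 < M := h.pos
  have ha : |a| < M := h
  have hM' : 0 < M' := box_mass_pos h hbox
  obtain ⟨hM'ge, -⟩ := box_mass_bounds h hbox
  have hsub' : |a'| < M' := isSubextremal_of_box h hbox
  have hχ2 := mass_mul_kappaSq_le h
  have hχ1 := sub_abs_le_mass_mul_kappaSq h
  have h3 : |a| ≤ |a'| + |a' - a| := by
    calc |a| = |a' - (a' - a)| := by ring_nf
      _ ≤ |a'| + |a' - a| := abs_sub _ _
  have hu' : M' - |a'| ≤ 5 * (M - |a|) / 4 := by
    nlinarith [le_abs_self (M' - M), abs_nonneg (a' - a)]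
  -- `χ' ≤ 2 (M' - |a'|)/M'`
  have hχ' : 1 - (a' / M') ^ 2 ≤ 2 * ((M' - |a'|) / M') := by
    have e : 1 - (a' / M') ^ 2 = (M' - |a'|) / M' * ((M' + |a'|) / M') := by
      field_simp
      rw [← sq_abs a']
      ring
    rw [e]
    have h1 : (M' + |a'|) / M' ≤ 2 := by
      rw [div_le_iff₀ hM']; linarith
    have h0 : 0 ≤ (M' - |a'|) / M' := div_nonneg (by linarith) hM'.le
    nlinarith [mul_le_mul_of_nonneg_left h1 h0]
  have hstep : 2 * ((M' - |a'|) / M') ≤ 3 * (1 - (a / M) ^ 2) := by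
    rw [← mul_div_assoc, div_le_iff₀ hM']
    -- goal: 2 (M' - |a'|) ≤ 3 χ M'
    have hχ0 := (kappaSq_pos_le_one h).1
    have : 3 * (1 - (a / M) ^ 2) * (7 * M / 8) ≤ 3 * (1 - (a / M) ^ 2) * M' :=
      mul_le_mul_of_nonneg_left hM'ge (by positivity)
    nlinarith
  exact hχ'.trans hstep

/-- **Constant conversion on the box**: for `p ≥ 0`, `χ'^{−p} ≤ 3^p χ^{−p}` — the corrected law's
constant at any box member, `C χ'^{−p}`, is bounded by `Λ := 3^p C χ^{−p}`. -/
theorem rpow_neg_box_le {M a M' a' p : ℝ} (h : Kerr.IsSubextremal M a)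
    (hbox : |M' - M| + |a' - a| ≤ M * (1 - (a / M) ^ 2) / 8) (hp : 0 ≤ p) :
    (1 - (a' / M') ^ 2) ^ (-p) ≤ (3 : ℝ) ^ p * (1 - (a / M) ^ 2) ^ (-p) := by
  obtain ⟨hχ0, -⟩ := kappaSq_pos_le_one h
  have hge := kappaSq_box_ge h hbox
  have hχ'0 : 0 < 1 - (a' / M') ^ 2 := by linarith [div_pos hχ0 (by norm_num : (0:ℝ) < 3)]
  calc (1 - (a' / M') ^ 2) ^ (-p) ≤ ((1 - (a / M) ^ 2) / 3) ^ (-p) :=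
        Real.rpow_le_rpow_of_nonpos (by positivity) hge (by linarith)
    _ = (3 : ℝ) ^ p * (1 - (a / M) ^ 2) ^ (-p) := by
        rw [Real.div_rpow hχ0.le (by norm_num), Real.rpow_neg (by norm_num : (0:ℝ) ≤ 3),
          div_eq_mul_inv, inv_inv, mul_comm]

/-- **Spin bookkeeping on the box**: if the reference spin satisfies `|a| ≥ ((2a₁ + 1)/3)·M` (a
threshold `< M` for `a₁ < 1`), every box spin lies in the range `a₁ M' ≤ |a'|` on which the corrected
`C⁺` is stated — so a reshaped composition takes the crux's `a₁_crux := (2a₁ + 1)/3`. -/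
theorem box_spin_ge {M a M' a' a₁ : ℝ} (h : Kerr.IsSubextremal M a)
    (hbox : |M' - M| + |a' - a| ≤ M * (1 - (a / M) ^ 2) / 8) (ha : (2 * a₁ + 1) / 3 * M ≤ |a|) :
    a₁ * M' ≤ |a'| := by
  have hM : 0 < M := h.pos
  have haM : |a| < M := h
  have hχ2 := mass_mul_kappaSq_le h
  obtain ⟨hM'ge, hM'le⟩ := box_mass_bounds h hbox
  have h3 : |a| ≤ |a'| + |a' - a| := by
    calc |a| = |a' - (a' - a)| := by ring_nf
      _ ≤ |a'| + |a' - a| := abs_sub _ _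
  -- `|a'| ≥ |a| - Mχ/8` and `M' ≤ M + Mχ/8`
  have ha' : |a| - M * (1 - (a / M) ^ 2) / 8 ≤ |a'| := by linarith [abs_nonneg (M' - M)]
  have hM'' : M' ≤ M + M * (1 - (a / M) ^ 2) / 8 := by
    linarith [le_abs_self (M' - M), abs_nonneg (a' - a)]
  by_cases ha₁ : a₁ ≤ 0
  · have : a₁ * M' ≤ 0 := mul_nonpos_of_nonpos_of_nonneg ha₁ (by linarith)
    linarith [abs_nonneg a']
  · push Not at ha₁
    -- `a₁ (M + Mχ/8) ≤ |a| - Mχ/8` from `Mχ ≤ 2(M - |a|)` and `|a| ≥ (2a₁+1)M/3`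
    have key : a₁ * (M + M * (1 - (a / M) ^ 2) / 8) ≤ |a| - M * (1 - (a / M) ^ 2) / 8 := by
      have ha₁1 : a₁ < 1 := by
        by_contra h1
        push Not at h1
        have : M ≤ (2 * a₁ + 1) / 3 * M := by nlinarith
        linarith
      nlinarith [(kappaSq_pos_le_one h).1]
    calc a₁ * M' ≤ a₁ * (M + M * (1 - (a / M) ^ 2) / 8) :=
          mul_le_mul_of_nonneg_left hM'' ha₁.le
      _ ≤ |a| - M * (1 - (a / M) ^ 2) / 8 := key
      _ ≤ |a'| := ha'

/-- The threshold `(2a₁ + 1)/3` is `< 1` for `a₁ < 1` (so it is an admissible crux `a₁`). -/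
theorem box_threshold_lt_one {a₁ : ℝ} (h : a₁ < 1) : (2 * a₁ + 1) / 3 < 1 := by linarith

end Summit.FinalStateConjecture.FinalStateConjecture.Theorems.NearExtremalKappaCapture.Negative

end
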